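import Literature.Probability.LatticeModels.CorrelationInequalities
import Literature.Probability.LatticeModels.MagnetizationContinuity
import Literature.Probability.LatticeModels.SharpnessProofs
import Mathlib.Analysis.Calculus.Deriv.MeanValue
import Mathlib.Analysis.Calculus.Deriv.Inv
import Mathlib.Analysis.SpecialFunctions.ExpDeriv
import Mathlib.Analysis.SpecialFunctions.Trigonometric.DerivHyp
import HarnessLib

/-!
# Griffiths monotonicity in `β`: finite volume, and left-continuity of the free state

Trunk G02 (T-STATMECH), topic `Probability/LatticeModels`; namespaces `Literature.StatMech`
(finite-volume calculus, any finite graph) and `Literature.CritIsing` (consequences on `ℤ^d`).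

Classical consequences of the second Griffiths (GKS II) inequality (Griffiths, J. Math. Phys. 8
(1967) 478/484; Kelly–Sherman 1968; Friedli–Velenik 2017, Thm. 3.20, Exercises 3.12, 3.16 and
§3.7), proved here from the tree's finite-volume named fact `Literature.Probability.LatticeModels.gks_two`:

* `hasDerivAt_isingExpect` — the finite-volume Gibbs average `β ↦ ⟨f⟩_{Λ;β,h}^{bc}` is
  differentiable with derivative the covariance `⟨(-ℋ) f⟩ - ⟨-ℋ⟩⟨f⟩` (elementary calculus on
  the finite Boltzmann sums of `integral_isingMeasure`; Friedli–Velenik 2017, eq. (3.8) and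
  Exercise 3.13); `continuous_isingExpect`;
* `deriv_isingCorr_free_nonneg`, `monotoneOn_isingCorr_free` — for the **free** boundary
  condition, `β ≥ 0`, `h ≥ 0`, `A ⊆ Λ`: `d/dβ ⟨σ_A⟩^∅_{Λ;β,h} = ∑_{xy ∈ ℰ_Λ}(⟨σ_xσ_yσ_A⟩ -
  ⟨σ_xσ_y⟩⟨σ_A⟩) + h ∑_x (⟨σ_xσ_A⟩ - ⟨σ_x⟩⟨σ_A⟩) ≥ 0` by GKS II, hence `β ↦ ⟨σ_A⟩^∅_{Λ;β,h}`
  is nondecreasing on `[0, ∞)` (Friedli–Velenik 2017, Exercise 3.13 / §3.7.2);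
* `freePair_mono_of_gks`, `freePair_leftContinuous_of_gks` — on `ℤ^d`, granting in addition
  the tree facts `isingCorr_free_mono_volume` (GKS monotonicity in the volume, F–V Exercise
  3.12) and `hasBoxLimit_isingCorr_free` (existence of the free state, F–V Exercise 3.16): the
  free-state pair correlation `β ↦ ⟨σ_xσ_y⟩^∅_β` is nondecreasing on `[0,∞)` and
  **left-continuous** at every `β₀ > 0`, being the supremum (increasing limit in the volume) of
  the continuous nondecreasing functions `β ↦ ⟨σ_xσ_y⟩^∅_{Λ_L;β}` (the "standard
  semicontinuity argument" of Aizenman–Duminil-Copin–Sidoravicius, CMP 334 (2015), §3.3,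
  arXiv v3 eq. (3.18)).

Also: `spinProduct_mul_spinProduct` (`σ_A σ_B = σ_{A ∆ B}`), linearity of `isingExpect` on
measurable observables (`isingExpect_add'`, `isingExpect_const_mul'`, `isingExpect_finset_sum'`).

## Mathlib status

No Ising model in Mathlib. Calculus anchors: `HasDerivAt.fun_sum`, `HasDerivAt.div`,
`Real.hasDerivAt_exp`, `monotoneOn_of_deriv_nonneg`; order/topology: `Ioo_mem_nhdsLT`,
`Metric.tendsto_nhds`.
-/

noncomputable section

open MeasureTheory Finset Filter Topology
open scoped symmDiff

namespace Literature.Probability.LatticeModels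

/-! ### Spin-product algebra -/

section SpinAlgebra

variable {V : Type*} [DecidableEq V]

/-- `σ_A σ_B = σ_{A ∆ B}` since `σ_x² = 1` (Friedli–Velenik 2017, §3.6.1 / statement of GKS II). [cite: FriedliVelenik2017, §3.6.1] -/
theorem spinProduct_mul_spinProduct (A B : Finset V) (s : SpinConfig V) :
    spinProduct A s * spinProduct B s = spinProduct (A ∆ B) s := by
  unfold spinProduct
  have h1 : ∏ x ∈ A, spinAt x s = (∏ x ∈ A \ B, spinAt x s) * ∏ x ∈ A ∩ B, spinAt x s := by
    rw [← prod_union (disjoint_sdiff_inter A B), sdiff_union_inter]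
  have h2 : ∏ x ∈ B, spinAt x s = (∏ x ∈ B \ A, spinAt x s) * ∏ x ∈ A ∩ B, spinAt x s := by
    rw [inter_comm, ← prod_union (disjoint_sdiff_inter B A), sdiff_union_inter]
  have h3 : ∏ x ∈ A ∆ B, spinAt x s = (∏ x ∈ A \ B, spinAt x s) * ∏ x ∈ B \ A, spinAt x s := by
    rw [Finset.symmDiff_def, prod_union disjoint_sdiff_sdiff]
  have h4 : (∏ x ∈ A ∩ B, spinAt x s) * ∏ x ∈ A ∩ B, spinAt x s = 1 := by
    rw [← prod_mul_distrib]
    exact prod_eq_one fun x _ => spinAt_mul_self x s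
  rw [h1, h2, h3, mul_mul_mul_comm, h4, mul_one]

omit [DecidableEq V] in
/-- `σ_{{x}} = σ_x`. [folklore] -/
@[simp] theorem spinProduct_singleton (x : V) : spinProduct ({x} : Finset V) = spinAt x := by
  funext s
  simp [spinProduct]

/-- For `x ≠ y`, the bond observable of `s(x, y)` is `σ_{{x,y}}`. [folklore] -/
theorem bondSpin_mk_eq_spinProduct {x y : V} (hxy : x ≠ y) (s : SpinConfig V) :
    bondSpin s s(x, y) = spinProduct {x, y} s := by
  simp [spinProduct, Finset.prod_pair hxy]

end SpinAlgebra

/-! ### Finite-volume Gibbs averages as functions of `β` -/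

section Calculus

variable {V : Type*} (G : SimpleGraph V) [DecidableEq V] [G.LocallyFinite]
variable (Λ : Finset V) (h : ℝ) (bc : BoundaryCondition V)

/-- The finite-sum formula for `⟨f⟩_{Λ;β,h}^{bc}` (restating `integral_isingMeasure`). [cite: FriedliVelenik2017, §3.1, eq. (3.8)] -/
theorem isingExpect_eq_sum_div (β : ℝ) {f : SpinConfig V → ℝ} (hf : Measurable f) :
    isingExpect G Λ β h bc f =
      (∑ τ : Λ → ℤˣ, isingWeight G Λ β h bc τ * f (glue Λ τ bc)) /
        isingPartitionFunction G Λ β h bc :=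
  integral_isingMeasure G Λ β h bc hf

/-- Additivity of `⟨·⟩_{Λ;β,h}^{bc}` on measurable observables. [folklore] -/
theorem isingExpect_add' (β : ℝ) {f g : SpinConfig V → ℝ} (hf : Measurable f) (hg : Measurable g) :
    isingExpect G Λ β h bc (fun σ => f σ + g σ) = isingExpect G Λ β h bc f + isingExpect G Λ β h bc g := by
  rw [isingExpect_eq_sum_div G Λ h bc β (show Measurable (fun σ => f σ + g σ) from hf.add hg),
    isingExpect_eq_sum_div G Λ h bc β hf, isingExpect_eq_sum_div G Λ h bc β hg, ← add_div,
    ← sum_add_distrib]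
  simp only [mul_add]

/-- Homogeneity of `⟨·⟩_{Λ;β,h}^{bc}` on measurable observables. [folklore] -/
theorem isingExpect_const_mul' (β c : ℝ) {f : SpinConfig V → ℝ} (hf : Measurable f) :
    isingExpect G Λ β h bc (fun σ => c * f σ) = c * isingExpect G Λ β h bc f := by
  rw [isingExpect_eq_sum_div G Λ h bc β (show Measurable (fun σ => c * f σ) from hf.const_mul c),
    isingExpect_eq_sum_div G Λ h bc β hf, mul_div_assoc', mul_sum]
  congr 1
  exact sum_congr rfl fun τ _ => by ring

/-- Finite additivity of `⟨·⟩_{Λ;β,h}^{bc}` on measurable observables. [folklore] -/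
theorem isingExpect_finset_sum' {ι : Type*} (β : ℝ) (s : Finset ι) (f : ι → SpinConfig V → ℝ)
    (hf : ∀ i, Measurable (f i)) :
    isingExpect G Λ β h bc (fun σ => ∑ i ∈ s, f i σ) = ∑ i ∈ s, isingExpect G Λ β h bc (f i) := by
  classical
  induction s using Finset.induction_on with
  | empty => simpa using isingExpect_const G Λ β h bc 0
  | insert i s hi ih =>
    simp only [Finset.sum_insert hi]
    rw [isingExpect_add' G Λ h bc β (hf i) (Finset.measurable_sum _ fun j _ => hf j), ih]

/-- The Boltzmann weight `exp (-β ℋ(τ))` is differentiable in `β` with derivative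
`-ℋ(τ) exp (-β ℋ(τ))`. [folklore] -/
theorem hasDerivAt_isingWeight (β : ℝ) (τ : Λ → ℤˣ) :
    HasDerivAt (fun β => isingWeight G Λ β h bc τ)
      (-isingHamiltonian G Λ h bc (glue Λ τ bc) * isingWeight G Λ β h bc τ) β := by
  have h1 : HasDerivAt (fun β : ℝ => -β * isingHamiltonian G Λ h bc (glue Λ τ bc))
      (-isingHamiltonian G Λ h bc (glue Λ τ bc)) β := by
    simpa using (hasDerivAt_id β).neg.mul_const (isingHamiltonian G Λ h bc (glue Λ τ bc))
  unfold isingWeight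
  exact h1.exp.congr_deriv (by ring)

/-- Boltzmann-weighted sums are differentiable in `β`:
`d/dβ ∑_τ e^{-βℋ(τ)} f(τ) = ∑_τ e^{-βℋ(τ)} (-ℋ(τ)) f(τ)`. [folklore] -/
theorem hasDerivAt_boltzmannSum (β : ℝ) (f : SpinConfig V → ℝ) :
    HasDerivAt (fun β => ∑ τ : Λ → ℤˣ, isingWeight G Λ β h bc τ * f (glue Λ τ bc))
      (∑ τ : Λ → ℤˣ, isingWeight G Λ β h bc τ *
        (-isingHamiltonian G Λ h bc (glue Λ τ bc) * f (glue Λ τ bc))) β := by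
  refine HasDerivAt.fun_sum fun τ _ => ?_
  exact ((hasDerivAt_isingWeight G Λ h bc β τ).mul_const (f (glue Λ τ bc))).congr_deriv (by ring)

/-- The partition function is differentiable in `β`, `Z' = ∑_τ e^{-βℋ(τ)} (-ℋ(τ))`. [folklore] -/
theorem hasDerivAt_isingPartitionFunction (β : ℝ) :
    HasDerivAt (fun β => isingPartitionFunction G Λ β h bc)
      (∑ τ : Λ → ℤˣ, isingWeight G Λ β h bc τ *
        (-isingHamiltonian G Λ h bc (glue Λ τ bc))) β := by
  have := hasDerivAt_boltzmannSum G Λ h bc β (fun _ => 1)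
  simp only [mul_one] at this
  exact this

/-- **Derivative of a finite-volume Gibbs average in `β`** (Friedli–Velenik 2017, Exercise 3.13
/ proof of Lemma 3.31: differentiating (3.8)): for measurable `f`,
`d/dβ ⟨f⟩_{Λ;β,h}^{bc} = ⟨(-ℋ) f⟩ - ⟨-ℋ⟩ ⟨f⟩` (a covariance with the energy). [cite: FriedliVelenik2017, Exercise 3.13] -/
theorem hasDerivAt_isingExpect (β : ℝ) {f : SpinConfig V → ℝ} (hf : Measurable f) :
    HasDerivAt (fun β => isingExpect G Λ β h bc f)
      (isingExpect G Λ β h bc (fun σ => -isingHamiltonian G Λ h bc σ * f σ) -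
        isingExpect G Λ β h bc (fun σ => -isingHamiltonian G Λ h bc σ) *
          isingExpect G Λ β h bc f) β := by
  have hmH : Measurable fun σ : SpinConfig V => -isingHamiltonian G Λ h bc σ :=
    (measurable_isingHamiltonian G Λ h bc).neg
  have hfun : (fun β => isingExpect G Λ β h bc f) = fun β =>
      (∑ τ : Λ → ℤˣ, isingWeight G Λ β h bc τ * f (glue Λ τ bc)) /
        isingPartitionFunction G Λ β h bc := by
    funext β
    exact isingExpect_eq_sum_div G Λ h bc β hf
  rw [hfun]
  have hq := (hasDerivAt_boltzmannSum G Λ h bc β f).fun_div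
    (hasDerivAt_isingPartitionFunction G Λ h bc β) (isingPartitionFunction_pos G Λ β h bc).ne'
  refine hq.congr_deriv ?_
  rw [isingExpect_eq_sum_div G Λ h bc β (show Measurable (fun σ => -isingHamiltonian G Λ h bc σ * f σ)
      from hmH.mul hf), isingExpect_eq_sum_div G Λ h bc β hmH, isingExpect_eq_sum_div G Λ h bc β hf]
  have hZ := (isingPartitionFunction_pos G Λ β h bc).ne'
  field_simp

/-- Finite-volume Gibbs averages of measurable observables are continuous in `β`. [folklore] -/
theorem continuous_isingExpect {f : SpinConfig V → ℝ} (hf : Measurable f) :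
    Continuous fun β => isingExpect G Λ β h bc f :=
  continuous_iff_continuousAt.2 fun β => (hasDerivAt_isingExpect G Λ h bc β hf).continuousAt

/-- The energy covariance expanded over bonds and sites:
`⟨(-ℋ^{bc}_{Λ;h}) f⟩ = ∑_{e ∈ ℰ^{bc}_Λ} ⟨σ_e f⟩ + h ∑_{x ∈ Λ} ⟨σ_x f⟩`. [folklore] -/
theorem isingExpect_negHamiltonian_mul (β : ℝ) {f : SpinConfig V → ℝ} (hf : Measurable f) :
    isingExpect G Λ β h bc (fun σ => -isingHamiltonian G Λ h bc σ * f σ) =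
      ∑ e ∈ interactionEdges G Λ bc, isingExpect G Λ β h bc (fun σ => bondSpin σ e * f σ) +
        h * ∑ x ∈ Λ, isingExpect G Λ β h bc (fun σ => spinAt x σ * f σ) := by
  have hexp : (fun σ => -isingHamiltonian G Λ h bc σ * f σ) = fun σ =>
      (∑ e ∈ interactionEdges G Λ bc, bondSpin σ e * f σ) +
        h * ∑ x ∈ Λ, spinAt x σ * f σ := by
    funext σ
    simp only [isingHamiltonian, neg_sub, sub_neg_eq_add, add_mul, sum_mul, mul_sum, mul_assoc]
    ring
  rw [hexp, isingExpect_add' G Λ h bc β, isingExpect_finset_sum' G Λ h bc β,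
    isingExpect_const_mul' G Λ h bc β, isingExpect_finset_sum' G Λ h bc β]
  · exact fun x => (measurable_spinAt x).mul hf
  · exact Finset.measurable_sum _ fun x _ => (measurable_spinAt x).mul hf
  · exact fun e => (measurable_bondSpin e).mul hf
  · exact Finset.measurable_sum _ fun e _ => (measurable_bondSpin e).mul hf
  · exact (Finset.measurable_sum _ fun x _ => (measurable_spinAt x).mul hf).const_mul h

end Calculus

end Literature.Probability.LatticeModels

namespace Literature.Probability.LatticeModels

open Percolation

/-! ### GKS II ⇒ monotonicity in `β` (free boundary condition) -/

section Monotone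

variable {V : Type*} (G : SimpleGraph V) [DecidableEq V] [G.LocallyFinite]

/-- **`d/dβ ⟨σ_A⟩^∅_{Λ;β,h} ≥ 0`** (Griffiths 1967; Friedli–Velenik 2017, Exercise 3.13 with
Thm. 3.20): for the free boundary condition, `β ≥ 0`, `h ≥ 0`, `A ⊆ Λ`, the derivative
`∑_{xy ∈ ℰ_Λ} (⟨σ_{A ∆ {x,y}}⟩ - ⟨σ_{{x,y}}⟩⟨σ_A⟩) + h ∑_{x ∈ Λ} (⟨σ_{A ∆ {x}}⟩ - ⟨σ_x⟩⟨σ_A⟩)`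
is nonnegative by GKS II (`gks_two`, tree fact, taken as hypothesis). [cite: FriedliVelenik2017, Exercise 3.13] -/
theorem deriv_isingCorr_free_nonneg
    (hgks : ∀ (Λ A B : Finset V) (β h : ℝ) (bc : BoundaryCondition V),
      gks_two G (Λ := Λ) (A := A) (B := B) (β := β) (h := h) (bc := bc))
    {Λ A : Finset V} {β h : ℝ} (hβ : 0 ≤ β) (hh : 0 ≤ h) (hA : A ⊆ Λ) :
    0 ≤ deriv (fun β => isingCorr G Λ β h .free A) β := by
  have hD := hasDerivAt_isingExpect G Λ h .free β (measurable_spinProduct A)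
  have hH := isingExpect_negHamiltonian_mul G Λ h .free β (f := fun _ => (1 : ℝ)) measurable_const
  simp only [mul_one] at hH
  change 0 ≤ deriv (fun β => isingExpect G Λ β h .free (spinProduct A)) β
  rw [hD.deriv, isingExpect_negHamiltonian_mul G Λ h .free β (measurable_spinProduct A), hH]
  simp only [interactionEdges_free]
  -- rewrite as a sum of GKS II covariances
  have hedge : ∀ e ∈ edgesIn G Λ,
      0 ≤ isingExpect G Λ β h .free (fun σ => bondSpin σ e * spinProduct A σ) -
        isingExpect G Λ β h .free (fun σ => bondSpin σ e) * isingCorr G Λ β h .free A := by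
    intro e he
    obtain ⟨he', hmem⟩ := mem_edgesIn_iff.1 he
    induction e using Sym2.ind with
    | _ x y =>
      have hxy : x ≠ y := G.ne_of_adj ((SimpleGraph.mem_edgeSet G).1 he')
      have hB : ({x, y} : Finset V) ⊆ Λ := by
        intro z hz
        simp only [Finset.mem_insert, Finset.mem_singleton] at hz
        rcases hz with rfl | rfl
        · exact hmem _ (Sym2.mem_mk_left _ _)
        · exact hmem _ (Sym2.mem_mk_right _ _)
      have h1 : (fun σ : SpinConfig V => bondSpin σ s(x, y) * spinProduct A σ) =
          spinProduct ({x, y} ∆ A) := by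
        funext σ
        rw [bondSpin_mk_eq_spinProduct hxy, spinProduct_mul_spinProduct]
      have h2 : (fun σ : SpinConfig V => bondSpin σ s(x, y)) = spinProduct {x, y} := by
        funext σ
        rw [bondSpin_mk_eq_spinProduct hxy]
      rw [h1, h2, symmDiff_comm]
      have := hgks Λ A {x, y} β h .free hβ hh (Or.inl rfl) hA hB
      change isingCorr G Λ β h .free A * isingCorr G Λ β h .free {x, y} ≤
        isingCorr G Λ β h .free (A ∆ {x, y}) at this
      change 0 ≤ isingCorr G Λ β h .free (A ∆ {x, y}) -
        isingCorr G Λ β h .free {x, y} * isingCorr G Λ β h .free A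
      linarith [mul_comm (isingCorr G Λ β h .free A) (isingCorr G Λ β h .free {x, y})]
  have hsite : ∀ x ∈ Λ,
      0 ≤ isingExpect G Λ β h .free (fun σ => spinAt x σ * spinProduct A σ) -
        isingExpect G Λ β h .free (fun σ => spinAt x σ) * isingCorr G Λ β h .free A := by
    intro x hx
    have h1 : (fun σ : SpinConfig V => spinAt x σ * spinProduct A σ) = spinProduct ({x} ∆ A) := by
      funext σ
      rw [← spinProduct_singleton, spinProduct_mul_spinProduct]
    have h2 : (fun σ : SpinConfig V => spinAt x σ) = spinProduct {x} := by
      rw [spinProduct_singleton]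
    rw [h1, h2, symmDiff_comm]
    have := hgks Λ A {x} β h .free hβ hh (Or.inl rfl) hA (Finset.singleton_subset_iff.2 hx)
    change isingCorr G Λ β h .free A * isingCorr G Λ β h .free {x} ≤
      isingCorr G Λ β h .free (A ∆ {x}) at this
    change 0 ≤ isingCorr G Λ β h .free (A ∆ {x}) -
      isingCorr G Λ β h .free {x} * isingCorr G Λ β h .free A
    linarith [mul_comm (isingCorr G Λ β h .free A) (isingCorr G Λ β h .free {x})]
  have key : (∑ e ∈ edgesIn G Λ, isingExpect G Λ β h .free (fun σ => bondSpin σ e * spinProduct A σ) +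
      h * ∑ x ∈ Λ, isingExpect G Λ β h .free (fun σ => spinAt x σ * spinProduct A σ)) -
      (∑ e ∈ edgesIn G Λ, isingExpect G Λ β h .free (fun σ => bondSpin σ e) +
        h * ∑ x ∈ Λ, isingExpect G Λ β h .free (fun σ => spinAt x σ)) *
        isingExpect G Λ β h .free (spinProduct A) =
      ∑ e ∈ edgesIn G Λ, (isingExpect G Λ β h .free (fun σ => bondSpin σ e * spinProduct A σ) -
        isingExpect G Λ β h .free (fun σ => bondSpin σ e) * isingCorr G Λ β h .free A) +
      h * ∑ x ∈ Λ, (isingExpect G Λ β h .free (fun σ => spinAt x σ * spinProduct A σ) -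
        isingExpect G Λ β h .free (fun σ => spinAt x σ) * isingCorr G Λ β h .free A) := by
    rw [Finset.sum_sub_distrib, Finset.sum_sub_distrib, ← Finset.sum_mul, ← Finset.sum_mul]
    simp only [isingCorr]
    ring
  rw [key]
  exact add_nonneg (Finset.sum_nonneg hedge) (mul_nonneg hh (Finset.sum_nonneg hsite))

/-- **Griffiths monotonicity in `β`** (Griffiths 1967; Friedli–Velenik 2017, Exercise 3.13 and
§3.7.2): granting GKS II (`gks_two`), for the free boundary condition, `h ≥ 0` and `A ⊆ Λ`,
`β ↦ ⟨σ_A⟩^∅_{Λ;β,h}` is nondecreasing on `[0, ∞)`. [cite: FriedliVelenik2017, Exercise 3.13] -/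
theorem monotoneOn_isingCorr_free
    (hgks : ∀ (Λ A B : Finset V) (β h : ℝ) (bc : BoundaryCondition V),
      gks_two G (Λ := Λ) (A := A) (B := B) (β := β) (h := h) (bc := bc))
    {Λ A : Finset V} {h : ℝ} (hh : 0 ≤ h) (hA : A ⊆ Λ) :
    MonotoneOn (fun β => isingCorr G Λ β h .free A) (Set.Ici 0) := by
  refine monotoneOn_of_deriv_nonneg (convex_Ici 0)
    (continuous_isingExpect G Λ h .free (measurable_spinProduct A)).continuousOn
    (fun β _ => (hasDerivAt_isingExpect G Λ h .free β
      (measurable_spinProduct A)).differentiableAt.differentiableWithinAt) ?_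
  intro β hβ
  rw [interior_Ici] at hβ
  exact deriv_isingCorr_free_nonneg G hgks (le_of_lt hβ) hh hA

end Monotone

/-! ### The free state on `ℤ^d`: monotonicity and left-continuity in `β` -/

section Lattice

variable {d : ℕ}

/-- Box convergence of free pair correlations `⟨σ_xσ_y⟩^∅_{Λ_M;β,0} → ⟨σ_xσ_y⟩^∅_{β,0}` for
`β ≥ 0`, granting the existence of the free state (`hasBoxLimit_isingCorr_free`,
Friedli–Velenik 2017, Exercise 3.16); pair version of `Literature.Probability.LatticeModels.tendsto_isingTwoPoint_free`. [cite: FriedliVelenik2017, Exercise 3.16] -/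
theorem tendsto_isingTwoPoint_free_pair (hlim : hasBoxLimit_isingCorr_free d) {β : ℝ}
    (hβ : 0 ≤ β) (x y : Site d) :
    Tendsto (fun M : ℕ => isingTwoPoint (zdGraph d) (box d M) β 0 .free x y) atTop
      (𝓝 (freePair d β x y)) := by
  rcases eq_or_ne x y with rfl | hxy
  · simp only [isingTwoPoint_self, freePair_self]
    exact tendsto_const_nhds
  · have hs : spinProduct ({x, y} : Finset (Site d)) = spinPair x y := by
      funext s; simp [spinProduct, spinPair, Finset.prod_pair hxy]
    have h := hlim hβ le_rfl {x, y}
    simpa only [HasBoxLimit, isingCorr, freeCorr, freePair, isingTwoPoint, hs] using h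

/-- Finite-volume free pair correlations on boxes are bounded by the free state:
`⟨σ_xσ_y⟩^∅_{Λ_M;β,0} ≤ ⟨σ_xσ_y⟩^∅_{β,0}` for `x, y ∈ Λ_M`, `β ≥ 0` (volume monotonicity
`isingCorr_free_mono_volume`, F–V Exercise 3.12, and the box limit `hasBoxLimit_isingCorr_free`,
F–V Exercise 3.16). [cite: FriedliVelenik2017, Exercise 3.12] -/
theorem isingTwoPoint_free_box_le_freePair (hmono : isingCorr_free_mono_volume (d := d))
    (hlim : hasBoxLimit_isingCorr_free d) {β : ℝ} (hβ : 0 ≤ β) {M : ℕ} {x y : Site d}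
    (hx : x ∈ box d M) (hy : y ∈ box d M) :
    isingTwoPoint (zdGraph d) (box d M) β 0 .free x y ≤ freePair d β x y := by
  rcases eq_or_ne x y with rfl | hxy
  · simp
  refine ge_of_tendsto (tendsto_isingTwoPoint_free_pair hlim hβ x y) ?_
  filter_upwards [eventually_ge_atTop M] with L hL
  rw [isingTwoPoint_eq_isingCorr _ _ _ _ _ hxy, isingTwoPoint_eq_isingCorr _ _ _ _ _ hxy]
  refine hmono hβ le_rfl ?_ (box_mono d hL)
  intro z hz
  simp only [Finset.mem_insert, Finset.mem_singleton] at hz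
  rcases hz with rfl | rfl
  · exact hx
  · exact hy

/-- Finite-volume free pair correlations on a box are nondecreasing in `β ≥ 0`, granting
GKS II (Friedli–Velenik 2017, Exercise 3.13). [cite: FriedliVelenik2017, Exercise 3.13] -/
theorem monotoneOn_isingTwoPoint_free_box
    (hgks : ∀ (Λ A B : Finset (Site d)) (β h : ℝ) (bc : BoundaryCondition (Site d)),
      gks_two (zdGraph d) (Λ := Λ) (A := A) (B := B) (β := β) (h := h) (bc := bc))
    {M : ℕ} {x y : Site d} (hx : x ∈ box d M) (hy : y ∈ box d M) :
    MonotoneOn (fun β => isingTwoPoint (zdGraph d) (box d M) β 0 .free x y) (Set.Ici 0) := by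
  rcases eq_or_ne x y with rfl | hxy
  · simp only [isingTwoPoint_self]
    exact monotoneOn_const
  simp only [isingTwoPoint_eq_isingCorr _ _ _ _ _ hxy]
  refine monotoneOn_isingCorr_free (zdGraph d) hgks le_rfl ?_
  intro z hz
  simp only [Finset.mem_insert, Finset.mem_singleton] at hz
  rcases hz with rfl | rfl
  · exact hx
  · exact hy

/-- **The free-state pair correlation is nondecreasing in `β`** on `[0, ∞)`
(Griffiths 1967; Friedli–Velenik 2017, Exercise 3.13 and §3.7.2 in the limit `Λ ↑ ℤ^d`),
granting GKS II and the existence of the free state. [cite: FriedliVelenik2017, Exercise 3.13] -/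
theorem freePair_mono_of_gks
    (hgks : ∀ (Λ A B : Finset (Site d)) (β h : ℝ) (bc : BoundaryCondition (Site d)),
      gks_two (zdGraph d) (Λ := Λ) (A := A) (B := B) (β := β) (h := h) (bc := bc))
    (hlim : hasBoxLimit_isingCorr_free d) (x y : Site d) :
    MonotoneOn (fun β => freePair d β x y) (Set.Ici 0) := by
  intro β₁ hβ₁ β₂ hβ₂ h12
  obtain ⟨M₀, hM₀⟩ := exists_mem_box_and' x y
  refine le_of_tendsto_of_tendsto (tendsto_isingTwoPoint_free_pair hlim hβ₁ x y)
    (tendsto_isingTwoPoint_free_pair hlim hβ₂ x y) ?_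
  filter_upwards [eventually_ge_atTop M₀] with M hM
  exact monotoneOn_isingTwoPoint_free_box hgks (hM₀ M hM).1 (hM₀ M hM).2 hβ₁ hβ₂ h12
where
  /-- Every pair of sites lies in a common box. -/
  exists_mem_box_and' (x y : Site d) : ∃ M₀ : ℕ, ∀ M, M₀ ≤ M → x ∈ box d M ∧ y ∈ box d M :=
    ⟨max (Site.supNorm x) (Site.supNorm y), fun _ hM =>
      ⟨mem_box_iff_supNorm_le.2 (le_trans (le_max_left _ _) hM),
        mem_box_iff_supNorm_le.2 (le_trans (le_max_right _ _) hM)⟩⟩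

/-- **Left-continuity of the free state in `β`** (Aizenman–Duminil-Copin–Sidoravicius, CMP 334
(2015), §3.3, arXiv v3 eq. (3.18): "`⟨σ_xσ_y⟩⁰_{Λ_L,β}` are monotone increasing functions of
`β` and also monotone increasing in `L`. Standard semicontinuity arguments … allow to conclude
that `⟨σ_xσ_y⟩⁰_{β_c} = lim_{β ↗ β_c} lim_{L → ∞} ⟨σ_xσ_y⟩⁰_{Λ_L,β}`"), here at every `β₀ > 0`
and granting the classical inputs as tree facts: GKS II (`gks_two`), volume monotonicity
(`isingCorr_free_mono_volume`, F–V Exercise 3.12) and the existence of the free state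
(`hasBoxLimit_isingCorr_free`, F–V Exercise 3.16). Proof: `f(β) = ⟨σ_xσ_y⟩^∅_β` is the
supremum over `L` of the continuous nondecreasing `f_L(β) = ⟨σ_xσ_y⟩^∅_{Λ_L;β}`, hence lower
semicontinuous and nondecreasing, hence left-continuous. [cite: AizenmanDuminilCopinSidoraviciusCMP2015, §3.3, arXiv v3 eq. (3.18)] -/
theorem freePair_leftContinuous_of_gks
    (hgks : ∀ (Λ A B : Finset (Site d)) (β h : ℝ) (bc : BoundaryCondition (Site d)),
      gks_two (zdGraph d) (Λ := Λ) (A := A) (B := B) (β := β) (h := h) (bc := bc))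
    (hmono : isingCorr_free_mono_volume (d := d)) (hlim : hasBoxLimit_isingCorr_free d)
    {β₀ : ℝ} (hβ₀ : 0 < β₀) (x y : Site d) :
    Tendsto (fun β => freePair d β x y) (𝓝[<] β₀) (𝓝 (freePair d β₀ x y)) := by
  rw [Metric.tendsto_nhds]
  intro ε hε
  obtain ⟨M₀, hM₀⟩ := freePair_mono_of_gks.exists_mem_box_and' x y
  -- choose a box on which the finite-volume correlation at β₀ is ε/2-close to the limit
  have hconv := tendsto_isingTwoPoint_free_pair hlim hβ₀.le x y
  rw [Metric.tendsto_nhds] at hconv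
  obtain ⟨M, hM, hMε⟩ := ((hconv (ε / 2) (half_pos hε)).and (eventually_ge_atTop M₀)).exists
  have hxM : x ∈ box d M := (hM₀ M hMε).1
  have hyM : y ∈ box d M := (hM₀ M hMε).2
  -- continuity of the finite-volume correlation at β₀
  have hcont := (continuous_isingExpect (zdGraph d) (box d M) 0 .free
    (measurable_spinPair x y)).continuousAt (x := β₀)
  rw [ContinuousAt, Metric.tendsto_nhds] at hcont
  have hnear := hcont (ε / 2) (half_pos hε)
  -- restrict to `(0, β₀)` from the left
  have hIoo : Set.Ioo 0 β₀ ∈ 𝓝[<] β₀ := Ioo_mem_nhdsLT hβ₀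
  filter_upwards [nhdsWithin_le_nhds hnear, hIoo, self_mem_nhdsWithin] with β hβ hβI hβlt
  have hβ0 : 0 ≤ β := hβI.1.le
  have hle : freePair d β x y ≤ freePair d β₀ x y :=
    freePair_mono_of_gks hgks hlim x y hβ0 hβ₀.le (le_of_lt hβlt)
  have hge : isingTwoPoint (zdGraph d) (box d M) β 0 .free x y ≤ freePair d β x y :=
    isingTwoPoint_free_box_le_freePair hmono hlim hβ0 hxM hyM
  rw [Real.dist_eq] at hM hβ ⊢
  change |isingTwoPoint (zdGraph d) (box d M) β 0 .free x y -
    isingTwoPoint (zdGraph d) (box d M) β₀ 0 .free x y| < ε / 2 at hβ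
  rw [abs_sub_lt_iff] at hM hβ ⊢
  constructor <;> linarith [hM.1, hM.2, hβ.1, hβ.2]

end Lattice

end Literature.Probability.LatticeModels

/-! ## Part II. Griffiths monotonicity in the couplings: graphs and volumes

Consequences of GKS II for the dependence of free-boundary-condition correlations on the
underlying graph and on the volume (Griffiths 1967; Kelly–Sherman 1968; Friedli–Velenik 2017,
Exercise 3.31 with 3.30 — `⟨σ_A⟩_{Λ;𝐊}` is nondecreasing in nonnegative couplings `𝐊` — and
Exercise 3.12 — monotonicity in `Λ`). Since the tree's model has a uniform coupling `β` on a
simple graph, "raising couplings from `0` to `β`" is phrased as enlarging the graph, and proved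
by the finite product expansion `e^{βσ_e} = cosh β + σ_e sinh β` together with GKS II for the
smaller graph (no interpolation in the couplings is needed).
-/

namespace Literature.Probability.LatticeModels

section GraphAlgebra

variable {V : Type*} [DecidableEq V]

omit [DecidableEq V] in
/-- A bond observable takes only the values `±1`. [folklore] -/
theorem bondSpin_eq_one_or (σ : SpinConfig V) (e : Sym2 V) : bondSpin σ e = 1 ∨ bondSpin σ e = -1 := by
  induction e using Sym2.ind with
  | _ x y =>
    rw [bondSpin_mk]
    rcases spinAt_eq_one_or_eq_neg_one x σ with hx | hx <;>
      rcases spinAt_eq_one_or_eq_neg_one y σ with hy | hy <;> simp [hx, hy]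

omit [DecidableEq V] in
/-- `e^{β σ_e} = cosh β + σ_e sinh β` since `σ_e = ±1`. [folklore] -/
theorem exp_mul_bondSpin (β : ℝ) (σ : SpinConfig V) (e : Sym2 V) :
    Real.exp (β * bondSpin σ e) = Real.cosh β + Real.sinh β * bondSpin σ e := by
  rcases bondSpin_eq_one_or σ e with h | h
  · rw [h, mul_one, mul_one, Real.cosh_add_sinh]
  · rw [h, mul_neg_one, mul_neg_one, ← sub_eq_add_neg, Real.cosh_sub_sinh]

/-- For a non-diagonal pair, the bond observable is the spin product of its endpoints. [folklore] -/
theorem bondSpin_eq_spinProduct_toFinset {e : Sym2 V} (he : ¬e.IsDiag) (σ : SpinConfig V) :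
    bondSpin σ e = spinProduct e.toFinset σ := by
  induction e using Sym2.ind with
  | _ x y =>
    rw [Sym2.mk_isDiag_iff] at he
    rw [Sym2.toFinset_mk_eq, bondSpin_mk_eq_spinProduct he]

/-- **Products of bond observables are spin products**: for a finite set `F` of non-diagonal
pairs, `∏_{e ∈ F} σ_e = σ_{B(F)}` with `B(F)` the iterated symmetric difference of the endpoint
sets (`Finset.fold`), and `B(F)` lies inside the union of the endpoints. [folklore] -/
theorem prod_bondSpin_eq_spinProduct_fold (F : Finset (Sym2 V)) (hF : ∀ e ∈ F, ¬e.IsDiag)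
    (σ : SpinConfig V) :
    ∏ e ∈ F, bondSpin σ e = spinProduct (F.fold (fun s t : Finset V => s ∆ t) (∅ : Finset V) Sym2.toFinset) σ := by
  induction F using Finset.induction_on with
  | empty => simp [spinProduct]
  | insert e F heF ih =>
    rw [Finset.prod_insert heF, Finset.fold_insert heF,
      ih (fun e' he' => hF e' (Finset.mem_insert_of_mem he')),
      bondSpin_eq_spinProduct_toFinset (hF e (Finset.mem_insert_self e F)),
      spinProduct_mul_spinProduct]

/-- The folded endpoint set lies in the union of the endpoint sets. [folklore] -/
theorem fold_symmDiff_toFinset_subset (F : Finset (Sym2 V)) :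
    F.fold (fun s t : Finset V => s ∆ t) (∅ : Finset V) Sym2.toFinset ⊆ F.biUnion Sym2.toFinset := by
  induction F using Finset.induction_on with
  | empty => simp
  | insert e F heF ih =>
    rw [Finset.fold_insert heF, Finset.biUnion_insert]
    exact (Finset.symmDiff_subset_union).trans (Finset.union_subset_union le_rfl ih)

end GraphAlgebra

section GraphMonotone

variable {V : Type*} [DecidableEq V]

/-- Edges inside `Λ` are monotone in the graph. [folklore] -/
theorem edgesIn_mono_graph {G₁ G₂ : SimpleGraph V} [G₁.LocallyFinite] [G₂.LocallyFinite]
    (hle : G₁ ≤ G₂) (Λ : Finset V) : edgesIn G₁ Λ ⊆ edgesIn G₂ Λ := fun e he => by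
  rw [mem_edgesIn_iff] at he ⊢
  exact ⟨SimpleGraph.edgeSet_subset_edgeSet.2 hle he.1, he.2⟩

/-- The free Gibbs measure depends on the graph only through the edges inside `Λ`
(Friedli–Velenik 2017, §3.1, eq. (3.2)). [cite: FriedliVelenik2017, §3.1, eq. (3.2)] -/
theorem isingMeasure_free_congr_edgesIn {G₁ G₂ : SimpleGraph V} [G₁.LocallyFinite] [G₂.LocallyFinite]
    {Λ : Finset V} (hE : edgesIn G₁ Λ = edgesIn G₂ Λ) (β h : ℝ) :
    isingMeasure G₁ Λ β h .free = isingMeasure G₂ Λ β h .free := by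
  unfold isingMeasure
  congr 1
  funext σ
  simp only [isingHamiltonian, interactionEdges_free, hE]

/-- A positive measurable observable has positive finite-volume expectation. [folklore] -/
theorem isingExpect_pos (G : SimpleGraph V) [G.LocallyFinite] (Λ : Finset V) (β h : ℝ)
    (bc : BoundaryCondition V) {f : SpinConfig V → ℝ} (hf : Measurable f) (hpos : ∀ σ, 0 < f σ) :
    0 < isingExpect G Λ β h bc f := by
  rw [isingExpect_eq_sum_div G Λ h bc β hf]
  exact div_pos (Finset.sum_pos (fun τ _ => mul_pos (isingWeight_pos G Λ β h bc τ) (hpos _))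
    Finset.univ_nonempty) (isingPartitionFunction_pos G Λ β h bc)

/-- **Change of graph as a tilt.** For graphs `G₁ ≤ G₂` and the free boundary condition, with
`D = ℰ_Λ(G₂) ∖ ℰ_Λ(G₁)` and `W = ∏_{e ∈ D} e^{β σ_e}`:
`⟨f⟩_{Λ;G₂} ⟨W⟩_{Λ;G₁} = ⟨f W⟩_{Λ;G₁}` (the two Boltzmann weights differ by the factor `W`). [folklore] -/
theorem isingExpect_free_mul_of_le {G₁ G₂ : SimpleGraph V} [G₁.LocallyFinite] [G₂.LocallyFinite]
    (hle : G₁ ≤ G₂) (Λ : Finset V) (β h : ℝ) {f : SpinConfig V → ℝ} (hf : Measurable f) :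
    isingExpect G₂ Λ β h .free f *
        isingExpect G₁ Λ β h .free
          (fun σ => ∏ e ∈ edgesIn G₂ Λ \ edgesIn G₁ Λ, Real.exp (β * bondSpin σ e)) =
      isingExpect G₁ Λ β h .free
        (fun σ => f σ * ∏ e ∈ edgesIn G₂ Λ \ edgesIn G₁ Λ, Real.exp (β * bondSpin σ e)) := by
  set D := edgesIn G₂ Λ \ edgesIn G₁ Λ with hD
  have hWm : Measurable fun σ : SpinConfig V => ∏ e ∈ D, Real.exp (β * bondSpin σ e) :=
    Finset.measurable_prod _ fun e _ => Real.measurable_exp.comp ((measurable_bondSpin e).const_mul β)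
  -- the Boltzmann weights differ by the factor `W`
  have hw : ∀ τ : Λ → ℤˣ, isingWeight G₂ Λ β h .free τ =
      isingWeight G₁ Λ β h .free τ * ∏ e ∈ D, Real.exp (β * bondSpin (glue Λ τ .free) e) := by
    intro τ
    have hsplit : edgesIn G₂ Λ = edgesIn G₁ Λ ∪ D := by
      rw [hD, Finset.union_sdiff_of_subset (edgesIn_mono_graph hle Λ)]
    have hdisj : Disjoint (edgesIn G₁ Λ) D := by rw [hD]; exact Finset.disjoint_sdiff
    rw [isingWeight, isingWeight, ← Real.exp_sum, ← Real.exp_add]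
    congr 1
    simp only [isingHamiltonian, interactionEdges_free, hsplit, Finset.sum_union hdisj]
    rw [← Finset.mul_sum]
    ring
  rw [isingExpect_eq_sum_div G₂ Λ h .free β hf, isingExpect_eq_sum_div G₁ Λ h .free β hWm,
    isingExpect_eq_sum_div G₁ Λ h .free β
      (show Measurable (fun σ => f σ * ∏ e ∈ D, Real.exp (β * bondSpin σ e)) from hf.mul hWm)]
  have hZ₁ := (isingPartitionFunction_pos G₁ Λ β h .free).ne'
  have hZ₂ := (isingPartitionFunction_pos G₂ Λ β h .free).ne'
  have hZ₂' : isingPartitionFunction G₂ Λ β h .free =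
      ∑ τ : Λ → ℤˣ, isingWeight G₁ Λ β h .free τ *
        ∏ e ∈ D, Real.exp (β * bondSpin (glue Λ τ .free) e) := by
    unfold isingPartitionFunction
    exact Finset.sum_congr rfl fun τ _ => hw τ
  rw [div_mul_div_comm, div_eq_div_iff (mul_ne_zero hZ₂ hZ₁) hZ₁]
  simp_rw [hw]
  rw [hZ₂'] at hZ₂ ⊢
  have : ∑ τ : Λ → ℤˣ, isingWeight G₁ Λ β h .free τ *
      (∏ e ∈ D, Real.exp (β * bondSpin (glue Λ τ .free) e)) * f (glue Λ τ .free) =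
      ∑ τ : Λ → ℤˣ, isingWeight G₁ Λ β h .free τ *
        (f (glue Λ τ .free) * ∏ e ∈ D, Real.exp (β * bondSpin (glue Λ τ .free) e)) :=
    Finset.sum_congr rfl fun τ _ => by ring
  rw [this]
  ring

end GraphMonotone

end Literature.Probability.LatticeModels

namespace Literature.Probability.LatticeModels

open Percolation

section GraphMonotone

variable {V : Type*} [DecidableEq V]

/-- **Tilting by a ferromagnetic polynomial increases correlations** (GKS II consequence;
Friedli–Velenik 2017, Thm. 3.20 / eq. (3.22) summed with nonnegative coefficients): for the
free or `+` boundary condition, `β, h ≥ 0`, `A ⊆ Λ` and `W = ∑ᵢ cᵢ σ_{Bᵢ}` with `cᵢ ≥ 0`,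
`Bᵢ ⊆ Λ`: `⟨σ_A⟩⟨W⟩ ≤ ⟨σ_A W⟩`. [cite: FriedliVelenik2017, Thm. 3.20] -/
theorem isingCorr_mul_isingExpect_sum_le (G : SimpleGraph V) [G.LocallyFinite]
    (hgks : ∀ (Λ A B : Finset V) (β h : ℝ) (bc : BoundaryCondition V),
      gks_two G (Λ := Λ) (A := A) (B := B) (β := β) (h := h) (bc := bc))
    {Λ A : Finset V} {β h : ℝ} {bc : BoundaryCondition V} (hβ : 0 ≤ β) (hh : 0 ≤ h)
    (hbc : bc = .free ∨ bc = .plus) (hA : A ⊆ Λ)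
    {ι : Type*} (s : Finset ι) (c : ι → ℝ) (B : ι → Finset V)
    (hc : ∀ i ∈ s, 0 ≤ c i) (hB : ∀ i ∈ s, B i ⊆ Λ) :
    isingCorr G Λ β h bc A * isingExpect G Λ β h bc (fun σ => ∑ i ∈ s, c i * spinProduct (B i) σ) ≤
      isingExpect G Λ β h bc (fun σ => spinProduct A σ * ∑ i ∈ s, c i * spinProduct (B i) σ) := by
  have hmeas : ∀ i, Measurable fun σ : SpinConfig V => c i * spinProduct (B i) σ :=
    fun i => (measurable_spinProduct (B i)).const_mul (c i)
  have h1 : isingExpect G Λ β h bc (fun σ => ∑ i ∈ s, c i * spinProduct (B i) σ) =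
      ∑ i ∈ s, c i * isingCorr G Λ β h bc (B i) := by
    rw [isingExpect_finset_sum' G Λ h bc β s _ hmeas]
    exact Finset.sum_congr rfl fun i _ =>
      isingExpect_const_mul' G Λ h bc β (c i) (measurable_spinProduct (B i))
  have h2 : isingExpect G Λ β h bc (fun σ => spinProduct A σ * ∑ i ∈ s, c i * spinProduct (B i) σ) =
      ∑ i ∈ s, c i * isingCorr G Λ β h bc (A ∆ B i) := by
    have hfun : (fun σ => spinProduct A σ * ∑ i ∈ s, c i * spinProduct (B i) σ) =
        fun σ => ∑ i ∈ s, c i * spinProduct (A ∆ B i) σ := by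
      funext σ
      rw [Finset.mul_sum]
      exact Finset.sum_congr rfl fun i _ => by rw [← spinProduct_mul_spinProduct]; ring
    rw [hfun, isingExpect_finset_sum' G Λ h bc β s _
      (fun i => (measurable_spinProduct (A ∆ B i)).const_mul (c i))]
    exact Finset.sum_congr rfl fun i _ =>
      isingExpect_const_mul' G Λ h bc β (c i) (measurable_spinProduct (A ∆ B i))
  rw [h1, h2, Finset.mul_sum]
  refine Finset.sum_le_sum fun i hi => ?_
  have := hgks Λ A (B i) β h bc hβ hh hbc hA (hB i hi)
  calc isingCorr G Λ β h bc A * (c i * isingCorr G Λ β h bc (B i))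
      = c i * (isingCorr G Λ β h bc A * isingCorr G Λ β h bc (B i)) := by ring
    _ ≤ c i * isingCorr G Λ β h bc (A ∆ B i) := mul_le_mul_of_nonneg_left this (hc i hi)

/-- **Griffiths monotonicity in the graph** (Friedli–Velenik 2017, Exercise 3.31 with Exercise
3.30: correlations are nondecreasing in nonnegative couplings; Griffiths 1967, Kelly–Sherman
1968): for graphs `G₁ ≤ G₂` on the same vertex set, the free boundary condition, `β ≥ 0`,
`h ≥ 0` and `A ⊆ Λ`, `⟨σ_A⟩^∅_{Λ;β,h}(G₁) ≤ ⟨σ_A⟩^∅_{Λ;β,h}(G₂)`, granting GKS II for `G₁`.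
Proof: `⟨σ_A⟩_{G₂}⟨W⟩_{G₁} = ⟨σ_A W⟩_{G₁} ≥ ⟨σ_A⟩_{G₁}⟨W⟩_{G₁}` with
`W = ∏_{e ∈ D}(cosh β + σ_e sinh β)` expanded into spin products with nonnegative
coefficients. [cite: FriedliVelenik2017, Exercise 3.31] -/
theorem isingCorr_free_mono_graph {G₁ G₂ : SimpleGraph V} [G₁.LocallyFinite] [G₂.LocallyFinite]
    (hgks : ∀ (Λ A B : Finset V) (β h : ℝ) (bc : BoundaryCondition V),
      gks_two G₁ (Λ := Λ) (A := A) (B := B) (β := β) (h := h) (bc := bc))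
    (hle : G₁ ≤ G₂) {Λ A : Finset V} {β h : ℝ} (hβ : 0 ≤ β) (hh : 0 ≤ h) (hA : A ⊆ Λ) :
    isingCorr G₁ Λ β h .free A ≤ isingCorr G₂ Λ β h .free A := by
  set D := edgesIn G₂ Λ \ edgesIn G₁ Λ with hD
  have hDprop : ∀ e ∈ D, ¬e.IsDiag ∧ ∀ x ∈ e, x ∈ Λ := fun e he => by
    have he' := (mem_edgesIn_iff.1 (Finset.mem_sdiff.1 he).1)
    exact ⟨SimpleGraph.not_isDiag_of_mem_edgeSet _ he'.1, he'.2⟩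
  -- the tilt `W` and its expansion into spin products
  set W : SpinConfig V → ℝ := fun σ => ∏ e ∈ D, Real.exp (β * bondSpin σ e) with hW
  have hWexp : W = fun σ => ∑ t ∈ D.powerset,
      (Real.cosh β ^ #t * Real.sinh β ^ #(D \ t)) *
        spinProduct ((D \ t).fold (fun s t : Finset V => s ∆ t) (∅ : Finset V) Sym2.toFinset) σ := by
    funext σ
    simp only [hW, exp_mul_bondSpin]
    rw [Finset.prod_add]
    refine Finset.sum_congr rfl fun t ht => ?_
    rw [Finset.prod_const, Finset.prod_mul_distrib, Finset.prod_const,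
      prod_bondSpin_eq_spinProduct_fold _ fun e he => (hDprop e (Finset.mem_sdiff.1 he).1).1]
    ring
  have hWm : Measurable W :=
    Finset.measurable_prod _ fun e _ => Real.measurable_exp.comp ((measurable_bondSpin e).const_mul β)
  have hWpos : 0 < isingExpect G₁ Λ β h .free W :=
    isingExpect_pos G₁ Λ β h .free hWm fun σ => Finset.prod_pos fun e _ => Real.exp_pos _
  -- ⟨σ_A⟩₂ ⟨W⟩₁ = ⟨σ_A W⟩₁ ≥ ⟨σ_A⟩₁ ⟨W⟩₁
  have hkey := isingExpect_free_mul_of_le hle Λ β h (measurable_spinProduct A)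
  change isingCorr G₂ Λ β h .free A * isingExpect G₁ Λ β h .free W =
    isingExpect G₁ Λ β h .free (fun σ => spinProduct A σ * W σ) at hkey
  have hge : isingCorr G₁ Λ β h .free A * isingExpect G₁ Λ β h .free W ≤
      isingExpect G₁ Λ β h .free (fun σ => spinProduct A σ * W σ) := by
    rw [hWexp]
    refine isingCorr_mul_isingExpect_sum_le G₁ hgks hβ hh (Or.inl rfl) hA D.powerset _ _
      (fun t _ => mul_nonneg (pow_nonneg (Real.cosh_pos β).le _)
        (pow_nonneg (Real.sinh_nonneg_iff.2 hβ) _)) (fun t _ => ?_)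
    refine (fold_symmDiff_toFinset_subset _).trans (Finset.biUnion_subset.2 fun e he => ?_)
    intro x hx
    exact (hDprop e (Finset.mem_sdiff.1 he).1).2 x (Sym2.mem_toFinset.1 hx)
  rw [← hkey] at hge
  exact le_of_mul_le_mul_right hge hWpos

end GraphMonotone

section VolumeMonotone

variable {V : Type*} [DecidableEq V]

/-- **Free-boundary factorisation**: if every edge of `G` inside `Λ₂` already lies inside
`Λ₁ ⊆ Λ₂`, then the spins of `Λ₂ ∖ Λ₁` are independent of those in `Λ₁` under `μ^∅_{Λ₂}` and
`⟨σ_A⟩^∅_{Λ₂;β,h} = ⟨σ_A⟩^∅_{Λ₁;β,h}` for `A ⊆ Λ₁` (Friedli–Velenik 2017, §3.1; the partition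
function factorises). [cite: FriedliVelenik2017, §3.1] -/
theorem isingCorr_free_eq_of_edgesIn_subset (G : SimpleGraph V) [G.LocallyFinite]
    {Λ₁ Λ₂ : Finset V} (h12 : Λ₁ ⊆ Λ₂) (hE : edgesIn G Λ₂ ⊆ edgesIn G Λ₁) (β h : ℝ)
    {A : Finset V} (hA : A ⊆ Λ₁) :
    isingCorr G Λ₂ β h .free A = isingCorr G Λ₁ β h .free A := by
  classical
  -- restriction maps
  let r₁ : (Λ₂ → ℤˣ) → (Λ₁ → ℤˣ) := fun τ x => τ ⟨x, h12 x.2⟩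
  let r' : (Λ₂ → ℤˣ) → (↥(Λ₂ \ Λ₁) → ℤˣ) := fun τ x => τ ⟨x, (Finset.mem_sdiff.1 x.2).1⟩
  let e : (Λ₂ → ℤˣ) ≃ (Λ₁ → ℤˣ) × (↥(Λ₂ \ Λ₁) → ℤˣ) :=
    { toFun := fun τ => (r₁ τ, r' τ)
      invFun := fun p x => if hx : (x : V) ∈ Λ₁ then p.1 ⟨x, hx⟩
        else p.2 ⟨x, Finset.mem_sdiff.2 ⟨x.2, hx⟩⟩
      left_inv := fun τ => by
        funext x
        by_cases hx : (x : V) ∈ Λ₁ <;> simp [r₁, r', hx]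
      right_inv := fun p => by
        ext x
        · simp [r₁, x.2]
        · have hx : (x : V) ∉ Λ₁ := (Finset.mem_sdiff.1 x.2).2
          simp [r', hx] }
  -- the glued configurations agree on `Λ₁`
  have hglue : ∀ (τ : Λ₂ → ℤˣ) (x : V), x ∈ Λ₁ →
      glue Λ₂ τ .free x = glue Λ₁ (r₁ τ) .free x := fun τ x hx => by
    rw [glue_apply_of_mem _ _ _ (h12 hx), glue_apply_of_mem _ _ _ hx]
  have hspinAt : ∀ (τ : Λ₂ → ℤˣ) (x : V), x ∈ Λ₁ →
      spinAt x (glue Λ₂ τ .free) = spinAt x (glue Λ₁ (r₁ τ) .free) := fun τ x hx => by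
    simp only [spinAt, hglue τ x hx]
  have hprod : ∀ τ : Λ₂ → ℤˣ, spinProduct A (glue Λ₂ τ .free) = spinProduct A (glue Λ₁ (r₁ τ) .free) :=
    fun τ => Finset.prod_congr rfl fun x hx => hspinAt τ x (hA hx)
  have hEeq : edgesIn G Λ₂ = edgesIn G Λ₁ :=
    Finset.Subset.antisymm hE fun e he => by
      rw [mem_edgesIn_iff] at he ⊢
      exact ⟨he.1, fun x hx => h12 (he.2 x hx)⟩
  -- the extra Boltzmann factor of the sites of `Λ₂ ∖ Λ₁`
  let R : (↥(Λ₂ \ Λ₁) → ℤˣ) → ℝ := fun τ' =>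
    Real.exp (β * (h * ∑ x : ↥(Λ₂ \ Λ₁), ((τ' x : ℤ) : ℝ)))
  have hRpos : 0 < ∑ τ', R τ' := Finset.sum_pos (fun τ' _ => Real.exp_pos _) Finset.univ_nonempty
  have hw : ∀ τ : Λ₂ → ℤˣ, isingWeight G Λ₂ β h .free τ = isingWeight G Λ₁ β h .free (r₁ τ) * R (r' τ) := by
    intro τ
    rw [isingWeight, isingWeight, ← Real.exp_add]
    congr 1
    have hbond : ∑ e' ∈ edgesIn G Λ₁, bondSpin (glue Λ₂ τ .free) e' =
        ∑ e' ∈ edgesIn G Λ₁, bondSpin (glue Λ₁ (r₁ τ) .free) e' := by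
      refine Finset.sum_congr rfl fun e' he' => ?_
      obtain ⟨-, hmem⟩ := mem_edgesIn_iff.1 he'
      induction e' using Sym2.ind with
      | _ x y =>
        rw [bondSpin_mk, bondSpin_mk, hspinAt τ x (hmem x (Sym2.mem_mk_left _ _)),
          hspinAt τ y (hmem y (Sym2.mem_mk_right _ _))]
    have hfield : ∑ x ∈ Λ₂, spinAt x (glue Λ₂ τ .free) =
        ∑ x ∈ Λ₁, spinAt x (glue Λ₁ (r₁ τ) .free) + ∑ x : ↥(Λ₂ \ Λ₁), ((r' τ x : ℤ) : ℝ) := by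
      rw [← Finset.sum_sdiff h12, add_comm]
      congr 1
      · exact Finset.sum_congr rfl fun x hx => hspinAt τ x hx
      · rw [← Finset.sum_coe_sort]
        refine Finset.sum_congr rfl fun x _ => ?_
        simp only [spinAt, r', glue_apply_of_mem _ _ _ (Finset.mem_sdiff.1 x.2).1]
    simp only [isingHamiltonian, interactionEdges_free, hEeq, hbond, hfield]
    ring
  -- numerator and partition function factorise
  have hsum : ∀ g : (Λ₁ → ℤˣ) → ℝ,
      ∑ τ : Λ₂ → ℤˣ, isingWeight G Λ₂ β h .free τ * g (r₁ τ) =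
        (∑ τ₁ : Λ₁ → ℤˣ, isingWeight G Λ₁ β h .free τ₁ * g τ₁) * ∑ τ', R τ' := by
    intro g
    rw [← Equiv.sum_comp e.symm, Fintype.sum_prod_type, Finset.sum_mul_sum]
    refine Finset.sum_congr rfl fun τ₁ _ => Finset.sum_congr rfl fun τ' _ => ?_
    have h1 : r₁ (e.symm (τ₁, τ')) = τ₁ := congrArg Prod.fst (e.apply_symm_apply (τ₁, τ'))
    have h2 : r' (e.symm (τ₁, τ')) = τ' := congrArg Prod.snd (e.apply_symm_apply (τ₁, τ'))
    rw [hw, h1, h2]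
    ring
  have hZ : isingPartitionFunction G Λ₂ β h .free =
      isingPartitionFunction G Λ₁ β h .free * ∑ τ', R τ' := by
    have := hsum fun _ => 1
    simp only [mul_one] at this
    exact this
  unfold isingCorr
  rw [isingExpect_eq_sum_div G Λ₂ h .free β (measurable_spinProduct A),
    isingExpect_eq_sum_div G Λ₁ h .free β (measurable_spinProduct A), hZ]
  simp_rw [hprod]
  rw [hsum fun τ₁ => spinProduct A (glue Λ₁ τ₁ .free),
    mul_div_mul_right _ _ hRpos.ne']

/-- **Griffiths monotonicity in the volume from GKS II** (Friedli–Velenik 2017, Exercise 3.12: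
"Using the GKS inequalities, prove that … `⟨σ_A⟩^∅_{Λ₁;β,h} ≤ ⟨σ_A⟩^∅_{Λ₂;β,h}` for all
`A ⊂ Λ₁ ⊂ Λ₂`"): for any locally finite graph, granting GKS II for all its subgraphs. Proof:
delete the edges not inside `Λ₁` (graph monotonicity, `isingCorr_free_mono_graph`), after which
the measure on `Λ₂` factorises (`isingCorr_free_eq_of_edgesIn_subset`). [cite: FriedliVelenik2017, Exercise 3.12] -/
theorem isingCorr_free_mono_volume_of_gks (G : SimpleGraph V) [G.LocallyFinite]
    (hgks : ∀ (G' : SimpleGraph V) [G'.LocallyFinite] (Λ A B : Finset V) (β h : ℝ)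
      (bc : BoundaryCondition V),
      gks_two G' (Λ := Λ) (A := A) (B := B) (β := β) (h := h) (bc := bc))
    {β h : ℝ} (hβ : 0 ≤ β) (hh : 0 ≤ h) {Λ₁ Λ₂ A : Finset V} (hA : A ⊆ Λ₁) (h12 : Λ₁ ⊆ Λ₂) :
    isingCorr G Λ₁ β h .free A ≤ isingCorr G Λ₂ β h .free A := by
  classical
  -- the graph `G₁`: edges of `G` with both endpoints in `Λ₁`
  let G₁ : SimpleGraph V :=
    { Adj := fun x y => G.Adj x y ∧ x ∈ Λ₁ ∧ y ∈ Λ₁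
      symm := ⟨fun x y hxy => ⟨hxy.1.symm, hxy.2.2, hxy.2.1⟩⟩
      loopless := ⟨fun x hx => G.irrefl hx.1⟩ }
  haveI : G₁.LocallyFinite := fun v =>
    Fintype.ofFinset ((G.neighborFinset v).filter fun w => v ∈ Λ₁ ∧ w ∈ Λ₁) fun w => by
      simp [G₁, SimpleGraph.mem_neighborSet]
  have hle : G₁ ≤ G := fun x y hxy => hxy.1
  have hE₁ : edgesIn G₁ Λ₁ = edgesIn G Λ₁ := by
    ext e'
    rw [mem_edgesIn_iff, mem_edgesIn_iff]
    induction e' using Sym2.ind with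
    | _ x y =>
      simp only [SimpleGraph.mem_edgeSet, G₁]
      constructor
      · rintro ⟨⟨hxy, -, -⟩, hmem⟩
        exact ⟨hxy, hmem⟩
      · rintro ⟨hxy, hmem⟩
        exact ⟨⟨hxy, hmem x (Sym2.mem_mk_left _ _), hmem y (Sym2.mem_mk_right _ _)⟩, hmem⟩
  have hE₂ : edgesIn G₁ Λ₂ ⊆ edgesIn G₁ Λ₁ := fun e' he' => by
    rw [mem_edgesIn_iff] at he' ⊢
    refine ⟨he'.1, ?_⟩
    induction e' using Sym2.ind with
    | _ x y =>
      have hxy := (SimpleGraph.mem_edgeSet G₁).1 he'.1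
      intro z hz
      rcases Sym2.mem_iff.1 hz with rfl | rfl
      · exact hxy.2.1
      · exact hxy.2.2
  calc isingCorr G Λ₁ β h .free A
      = isingCorr G₁ Λ₁ β h .free A := by
        simp only [isingCorr, isingExpect, isingMeasure_free_congr_edgesIn hE₁]
    _ = isingCorr G₁ Λ₂ β h .free A :=
        (isingCorr_free_eq_of_edgesIn_subset G₁ h12 hE₂ β h hA).symm
    _ ≤ isingCorr G Λ₂ β h .free A :=
        isingCorr_free_mono_graph (fun Λ A B β h bc => hgks G₁ Λ A B β h bc) hle hβ hh (hA.trans h12)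

end VolumeMonotone

section LatticeVolume

variable {d : ℕ}

/-- **The tree fact `isingCorr_free_mono_volume` from GKS II**: volume monotonicity of free
correlations on `ℤ^d` (Friedli–Velenik 2017, Exercise 3.12), granting GKS II for all locally
finite graphs on `ℤ^d`. [cite: FriedliVelenik2017, Exercise 3.12] -/
theorem isingCorr_free_mono_volume_of_gks_two
    (hgks : ∀ (G' : SimpleGraph (Site d)) [G'.LocallyFinite] (Λ A B : Finset (Site d)) (β h : ℝ)
      (bc : BoundaryCondition (Site d)),
      gks_two G' (Λ := Λ) (A := A) (B := B) (β := β) (h := h) (bc := bc)) :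
    isingCorr_free_mono_volume (d := d) :=
  fun hβ hh _ _ _ hA h12 => isingCorr_free_mono_volume_of_gks (zdGraph d) hgks hβ hh hA h12

end LatticeVolume

end Literature.Probability.LatticeModels
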